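/-
COR-CM (cell pub-hodgecm2 = stage 2 of the Hodge ladder), seat b26 gen 18 (prover-pub-hodgecm2-b26-g18-0, 2026-08-21);
count-neutral for the binder table (no row).  Lane CM-SUBQUOT, Summits-side junction: the Literature
orthogonality `Hom(non-CM elliptic products, CM) = 0` (`Milne1999/CMTypeHomOrthogonality`) read in the
HODGE-THEORETIC phrasing `EllipticCurve.HodgeEndTrivial` used by the cell `pub-hodge-ring2`, through gen 17's
`PeriodCurve.isOfCMType_iff_not_hodgeEndTrivial_of_dim_eq_one`.  Theorems only: no definition, no named fact.
-/
import Summits.HodgeConjecture.CorCM.Assembly.EllipticCurvePeriod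
import Literature.AlgebraicGeometry.Milne1999.CMTypeHomOrthogonality
import HarnessLib

/-!
# `Hom(X, C) = 0 = Hom(C, X)` for `X ∼ ∏ E_i^{N_i+1}` with `HodgeEndTrivial E_i` and `C` of CM-type; CM-type of the pure elliptic class

For every complex elliptic curve `E` (`dim E = 1`), Milne's «of CM type» and Hodge-theoretic complex
multiplication agree: `IsOfCMType E ↔ ¬ EllipticCurve.HodgeEndTrivial E`
(`PeriodCurve.isOfCMType_iff_not_hodgeEndTrivial_of_dim_eq_one`, seat b26 gen 17: every elliptic curve
has a period `τ`, and both sides say `τ` is imaginary quadratic — Moonen–Zarhin (2.1), `g = 1`).  The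
Literature files `Milne1999/CMTypeSubquotients`, `…/CMTypeNonzeroHom`, `…/CMTypeHomOrthogonality` and
`HodgeTheory/MultiPowSuccCMType` (gen 18) give, in terms of `IsOfCMType`: abelian subvarieties /
quotients / factors of CM abelian varieties are CM, `Hom = 0` between CM abelian varieties and simple
non-CM ones, and `X ∼ E₀^{N₀+1} × ⋯ × E_r^{N_r+1} (× A)` is CM iff every `E_i` (and `A`) is.  This file
re-reads them with the hypothesis `HodgeEndTrivial (E i)` carried by the «pure elliptic class» theorems
of `pub-hodge-ring2` (`HodgeTheory/EllipticCurvesCMTypeProductsHodgeConjecture`,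
`…/NonCMEllipticCurvesProductsHodgeClasses`):

* `hom_eq_zero_of_isOfCMType_of_hodgeEndTrivial` / `hom_eq_zero_of_hodgeEndTrivial_of_isOfCMType` —
  **`Hom(A, E) = 0 = Hom(E, A)` for `A` of CM-type and `E` an elliptic curve with `HodgeEndTrivial E`**;
* `forall_hom_eq_zero_of_isIsogenous_multiPowSucc_of_hodgeEndTrivial` (and `_to_`) —
  **`Hom(X, C) = 0 = Hom(C, X)` for `X ∼ E₀^{N₀+1} × ⋯ × E_r^{N_r+1}`, all `E_i` with `HodgeEndTrivial`,
  and `C` of CM-type** (Moonen–Zarhin §3 (3.1): the hypothesis «`Hom(A, C) = 0`»);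
* `isOfCMType_multiPowSucc_iff_forall_not_hodgeEndTrivial`,
  `isOfCMType_iff_of_isIsogenous_multiPowSucc_prod_of_dim_eq_one` — `X ∼ (∏ E_i^{N_i+1}) × A` is of
  CM-type iff NO `E_i` has `HodgeEndTrivial` and `A` is of CM-type;
* `not_isOfCMType_of_isIsogenous_multiPowSucc_prod_of_hodgeEndTrivial` — one `E_i` with
  `HodgeEndTrivial` makes `X` non-CM: **the unconditional Hodge-conjecture theorems of the pure-elliptic
  × CM class (`hT : ∀ i, HodgeEndTrivial (E i)`) concern only abelian varieties `X` that are NOT of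
  CM-type** — their domain meets `HC_CM`'s only in the factor `A`.

HONEST SCOPE: structure statements about CM-type and Hom-sets; nothing here bears on HC_CM or on the summit.

## References
* [Milne1999] J. S. Milne, Compositio Math. 117 (1999), §2 p. 54.
* [MoonenZarhin1999LowDim] B. Moonen, Yu. Zarhin, Math. Ann. 315 (1999), §2 (2.1), §3 (3.1).
* [MumfordAV1970] D. Mumford, *Abelian Varieties* (1970), §19 Thm. 1, Cor. 1–2 (pp. 173–174).
-/

noncomputable section

open CategoryTheory
open Literature.AlgebraicGeometry.Motives Literature.AlgebraicGeometry.Motives.AbelianVariety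
open Literature.AlgebraicGeometry.HodgeTheory Literature.AlgebraicGeometry.Milne1999
open Summit.HodgeConjecture.CorCM.PeriodCurve

namespace Summit.HodgeConjecture.CorCM.CMOrthogonality

variable {A C E X : AbelianVariety ℂ}

/-! ## §1 `HodgeEndTrivial` versus `IsOfCMType` on elliptic curves -/

/-- An elliptic curve with `HodgeEndTrivial` is not of CM-type (`isOfCMType_iff_not_hodgeEndTrivial_of_dim_eq_one`).
[cite: MoonenZarhin1999LowDim, §2 (2.1) (g = 1)] [cite: Milne1999, §2 p. 54] -/
theorem not_isOfCMType_of_hodgeEndTrivial (hE : E.dim = 1) (hT : EllipticCurve.HodgeEndTrivial E) :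
    ¬ IsOfCMType E :=
  fun h => (isOfCMType_iff_not_hodgeEndTrivial_of_dim_eq_one hE).1 h hT

/-- An elliptic curve not of CM-type has `HodgeEndTrivial`. [cite: MoonenZarhin1999LowDim, §2 (2.1) (g = 1)]
[cite: Milne1999, §2 p. 54] -/
theorem hodgeEndTrivial_of_not_isOfCMType (hE : E.dim = 1) (h : ¬ IsOfCMType E) :
    EllipticCurve.HodgeEndTrivial E := by
  by_contra hT
  exact h ((isOfCMType_iff_not_hodgeEndTrivial_of_dim_eq_one hE).2 hT)

/-- `HodgeEndTrivial E ↔ ¬ IsOfCMType E` for an elliptic curve. [cite: MoonenZarhin1999LowDim, §2 (2.1) (g = 1)]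
[cite: Milne1999, §2 p. 54] -/
theorem hodgeEndTrivial_iff_not_isOfCMType (hE : E.dim = 1) :
    EllipticCurve.HodgeEndTrivial E ↔ ¬ IsOfCMType E :=
  ⟨not_isOfCMType_of_hodgeEndTrivial hE, hodgeEndTrivial_of_not_isOfCMType hE⟩

/-! ## §2 `Hom = 0` between CM abelian varieties and `HodgeEndTrivial` elliptic curves -/

/-- **Every homomorphism from a CM abelian variety to an elliptic curve with `HodgeEndTrivial` is
zero.** [cite: Milne1999, §2 p. 54] [cite: MoonenZarhin1999LowDim, §3 (3.1)] -/
theorem hom_eq_zero_of_isOfCMType_of_hodgeEndTrivial (hA : IsOfCMType A) (hE : E.dim = 1)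
    (hT : EllipticCurve.HodgeEndTrivial E) (f : A ⟶ E) : f = 0 :=
  hom_eq_zero_of_isOfCMType_of_not_isOfCMType_of_dim_eq_one hA hE
    (not_isOfCMType_of_hodgeEndTrivial hE hT) f

/-- **Every homomorphism from an elliptic curve with `HodgeEndTrivial` to a CM abelian variety is
zero.** [cite: Milne1999, §2 p. 54] [cite: MoonenZarhin1999LowDim, §3 (3.1)] -/
theorem hom_eq_zero_of_hodgeEndTrivial_of_isOfCMType (hE : E.dim = 1)
    (hT : EllipticCurve.HodgeEndTrivial E) (hA : IsOfCMType A) (f : E ⟶ A) : f = 0 :=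
  hom_eq_zero_of_not_isOfCMType_of_dim_eq_one_of_isOfCMType hE
    (not_isOfCMType_of_hodgeEndTrivial hE hT) hA f

/-- **`Hom(X, C) = 0` for `X ∼ E₀^{N₀+1} × ⋯ × E_r^{N_r+1}` with all `E_i` elliptic with `HodgeEndTrivial`,
and `C` of CM-type** (Moonen–Zarhin §3 (3.1), hypothesis «`Hom(A, C) = 0`»).
[cite: MoonenZarhin1999LowDim, §3 (3.1)] [cite: Milne1999, §2 p. 54]
[cite: MumfordAV1970, §19 Thm. 1 Cor. 1–2 (pp. 173–174)] -/
theorem forall_hom_eq_zero_of_isIsogenous_multiPowSucc_of_hodgeEndTrivial (r : ℕ)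
    (E : Fin (r + 1) → AbelianVariety ℂ) (N : Fin (r + 1) → ℕ) (hE : ∀ i, (E i).dim = 1)
    (hT : ∀ i, EllipticCurve.HodgeEndTrivial (E i)) (hX : X.IsIsogenous (multiPowSucc r E N))
    (hC : IsOfCMType C) : ∀ f : X ⟶ C, f = 0 :=
  forall_hom_eq_zero_of_isIsogenous_multiPowSucc_of_isOfCMType r E N hE
    (fun i => not_isOfCMType_of_hodgeEndTrivial (hE i) (hT i)) hX hC

/-- **`Hom(C, X) = 0` for `C` of CM-type and `X ∼ E₀^{N₀+1} × ⋯ × E_r^{N_r+1}` with all `E_i` elliptic with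
`HodgeEndTrivial`.** [cite: MoonenZarhin1999LowDim, §3 (3.1)] [cite: Milne1999, §2 p. 54]
[cite: MumfordAV1970, §19 Thm. 1 Cor. 1–2 (pp. 173–174)] -/
theorem forall_hom_to_eq_zero_of_isIsogenous_multiPowSucc_of_hodgeEndTrivial (r : ℕ)
    (E : Fin (r + 1) → AbelianVariety ℂ) (N : Fin (r + 1) → ℕ) (hE : ∀ i, (E i).dim = 1)
    (hT : ∀ i, EllipticCurve.HodgeEndTrivial (E i)) (hC : IsOfCMType C)
    (hX : X.IsIsogenous (multiPowSucc r E N)) : ∀ g : C ⟶ X, g = 0 :=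
  forall_hom_to_eq_zero_of_isIsogenous_multiPowSucc_of_isOfCMType r E N hE
    (fun i => not_isOfCMType_of_hodgeEndTrivial (hE i) (hT i)) hC hX

/-! ## §3 CM-type of the pure elliptic class, in `HodgeEndTrivial` terms -/

/-- **`E₀^{N₀+1} × ⋯ × E_r^{N_r+1}` (elliptic `E_i`) is of CM-type iff no `E_i` has `HodgeEndTrivial`.**
[cite: Milne1999, §2 p. 54] [cite: MoonenZarhin1999LowDim, §2 (2.1) (g = 1)] -/
theorem isOfCMType_multiPowSucc_iff_forall_not_hodgeEndTrivial (r : ℕ)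
    (E : Fin (r + 1) → AbelianVariety ℂ) (N : Fin (r + 1) → ℕ) (hE : ∀ i, (E i).dim = 1) :
    IsOfCMType (multiPowSucc r E N) ↔ ∀ i, ¬ EllipticCurve.HodgeEndTrivial (E i) := by
  rw [isOfCMType_multiPowSucc_iff]
  exact forall_congr' fun i => isOfCMType_iff_not_hodgeEndTrivial_of_dim_eq_one (hE i)

/-- **`X ∼ (E₀^{N₀+1} × ⋯ × E_r^{N_r+1}) × A` (elliptic `E_i`) is of CM-type iff no `E_i` has
`HodgeEndTrivial` and `A` is of CM-type.** [cite: Milne1999, §2 p. 54] [cite: MoonenZarhin1999LowDim, §2 (2.1) (g = 1)] -/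
theorem isOfCMType_iff_of_isIsogenous_multiPowSucc_prod_of_dim_eq_one (r : ℕ)
    (E : Fin (r + 1) → AbelianVariety ℂ) (N : Fin (r + 1) → ℕ) (A : AbelianVariety ℂ)
    (hE : ∀ i, (E i).dim = 1) (hX : X.IsIsogenous ((multiPowSucc r E N).prod A)) :
    IsOfCMType X ↔ (∀ i, ¬ EllipticCurve.HodgeEndTrivial (E i)) ∧ IsOfCMType A := by
  rw [isOfCMType_iff_of_isIsogenous_multiPowSucc_prod r E N A hX]
  exact and_congr_left' (forall_congr' fun i => isOfCMType_iff_not_hodgeEndTrivial_of_dim_eq_one (hE i))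

/-- **One elliptic factor with `HodgeEndTrivial` makes every `X ∼ (∏ E_j^{N_j+1}) × A` non-CM** — so the
unconditional Hodge-conjecture theorems of the pure-elliptic × CM class (hypothesis
`∀ i, HodgeEndTrivial (E i)`) concern only abelian varieties that are NOT of CM-type.
[cite: Milne1999, §2 p. 54] [cite: MoonenZarhin1999LowDim, §2 (2.1) (g = 1)] -/
theorem not_isOfCMType_of_isIsogenous_multiPowSucc_prod_of_hodgeEndTrivial (r : ℕ)
    (E : Fin (r + 1) → AbelianVariety ℂ) (N : Fin (r + 1) → ℕ) (A : AbelianVariety ℂ) {i : Fin (r + 1)}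
    (hE : (E i).dim = 1) (hT : EllipticCurve.HodgeEndTrivial (E i))
    (hX : X.IsIsogenous ((multiPowSucc r E N).prod A)) : ¬ IsOfCMType X :=
  not_isOfCMType_of_isIsogenous_multiPowSucc_prod r E N A hX (not_isOfCMType_of_hodgeEndTrivial hE hT)

/-- The same without the factor `A`: one `E_i` with `HodgeEndTrivial` makes every `X ∼ ∏ E_j^{N_j+1}` non-CM.
[cite: Milne1999, §2 p. 54] [cite: MoonenZarhin1999LowDim, §2 (2.1) (g = 1)] -/
theorem not_isOfCMType_of_isIsogenous_multiPowSucc_of_hodgeEndTrivial (r : ℕ)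
    (E : Fin (r + 1) → AbelianVariety ℂ) (N : Fin (r + 1) → ℕ) {i : Fin (r + 1)} (hE : (E i).dim = 1)
    (hT : EllipticCurve.HodgeEndTrivial (E i)) (hX : X.IsIsogenous (multiPowSucc r E N)) :
    ¬ IsOfCMType X :=
  not_isOfCMType_of_isIsogenous_multiPowSucc r E N hX (not_isOfCMType_of_hodgeEndTrivial hE hT)

/-- With the standing hypothesis `hT : ∀ i, HodgeEndTrivial (E i)` of the pure-elliptic × CM theorems:
`X ∼ (∏ E_i^{N_i+1}) × A` is never of CM-type (there is at least the factor `E₀`).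
[cite: Milne1999, §2 p. 54] [cite: MoonenZarhin1999LowDim, §2 (2.1) (g = 1)] -/
theorem not_isOfCMType_of_isIsogenous_multiPowSucc_prod_of_forall_hodgeEndTrivial (r : ℕ)
    (E : Fin (r + 1) → AbelianVariety ℂ) (N : Fin (r + 1) → ℕ) (A : AbelianVariety ℂ)
    (hE : ∀ i, (E i).dim = 1) (hT : ∀ i, EllipticCurve.HodgeEndTrivial (E i))
    (hX : X.IsIsogenous ((multiPowSucc r E N).prod A)) : ¬ IsOfCMType X :=
  not_isOfCMType_of_isIsogenous_multiPowSucc_prod_of_hodgeEndTrivial r E N A (hE 0) (hT 0) hX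

end Summit.HodgeConjecture.CorCM.CMOrthogonality
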